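import Summits.AtomisticToContinuum.Crystallization.Theorems.ExcessDecayLiouvillePhononStabilityFarDefs
import Summits.AtomisticToContinuum.Crystallization.Theorems.ExcessDecayLiouvillePhononStabilityPullback

/-!
# `PhononStability` (stmt-AtomisticToContinuum-9333), line `contragredient-window-collapse`: stub `stub_chainBound`

Sub-goal S6 of the reshaped line (`ChainBound`, the far-field device "chain identity + weighted
Cauchy–Schwarz"): for a chain `ch = [s₁, …, s_L]` of bond classes composing to the class `c`
(`IsChain c ch`), positive weights `ℓ_j = wt s_j`, a direction `v` and a finitely supported label field `w`,

`Σ_k ⟪v, Δ_c w k⟫² ≤ (Σ_j ℓ_j) · Σ_j ℓ_j⁻¹ · Σ_k ⟪v, Δ_{s_j} w k⟫²`,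

i.e. `dirForm v c w ≤ (ch.map wt).sum * (ch.map fun s => (wt s)⁻¹ * dirForm v s w).sum`.

Everything is one induction on the chain, generalising the start sublattice and the end label class
(`chain_aux`): if the chain started on sublattice `m` ends at the label class `(m', n)`
(`chainEnd m ch = some (m', n)`), there is a nonnegative summable `Q : ℤ³ → ℝ` — the weighted square sum
`Q k = Σ_j ℓ_j⁻¹ ⟪v, Δ_{s_j} w (k + o_j)⟫²` along the chain with offsets `o₁ = 0`, `o_{j+1} = o_j + n_{s_j}` — with

* **telescoping + pointwise weighted Cauchy–Schwarz:** `⟪v, w (m', k + n) − w (m, k)⟫² ≤ (Σ_j ℓ_j) · Q k`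
  for every base point `k` (the composite difference splits as `Δ_{s₁} w k + (composite of the tail at
  k + n_{s₁})`, and `(a + A)² ≤ (ℓ + P)(a²/ℓ + X)` whenever `A² ≤ P·X`, `sq_add_le`);
* **summation and re-indexing:** `Σ'_k Q k = Σ_j ℓ_j⁻¹ · dirForm v s_j w` (all families are finitely supported
  in `k` since `w` is, so `tsum` is additive, and `Σ'_k f (k + o) = Σ'_k f k` by `Equiv.tsum_eq (Equiv.addRight o)`).

For `ch` composing to `c` the composite difference is `Δ_c w k`, and `tsum` monotonicity concludes.
All `[folklore]`.
-/

noncomputable section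

open scoped BigOperators Classical InnerProductSpace
open Filter Set Function
open Literature.MathematicalPhysics.StatisticalMechanics
open Summit.AtomisticToContinuum.Crystallization.Theses.ExcessDecayLiouville
open Summit.AtomisticToContinuum.Crystallization.Theorems.PhononStabilityNegative
open Summit.AtomisticToContinuum.Crystallization.Theorems.PhononStabilityCWC

namespace Summit.AtomisticToContinuum.Crystallization.Theorems.PhononStabilityCWC.ChainBoundStub

/-- One step of the weighted Cauchy–Schwarz induction: `A² ≤ P·X` with `ℓ > 0`, `P, X ≥ 0` gives
`(a + A)² ≤ (ℓ + P)(a²/ℓ + X)`. [folklore] -/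
theorem sq_add_le {a A ℓ P X : ℝ} (hℓ : 0 < ℓ) (hP : 0 ≤ P) (hX : 0 ≤ X) (hA : A ^ 2 ≤ P * X) :
    (a + A) ^ 2 ≤ (ℓ + P) * (ℓ⁻¹ * a ^ 2 + X) := by
  have hℓ0 : ℓ ≠ 0 := hℓ.ne'
  have key : 2 * a * A ≤ ℓ * X + P * (ℓ⁻¹ * a ^ 2) := by
    rcases hP.eq_or_lt with rfl | hP'
    · have hA0 : A = 0 := pow_eq_zero_iff two_ne_zero |>.mp (le_antisymm (by simpa using hA) (sq_nonneg A))
      subst hA0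
      simpa using mul_nonneg hℓ.le hX
    · have h : P * ℓ * (2 * a * A) ≤ P * ℓ * (ℓ * X + P * (ℓ⁻¹ * a ^ 2)) := by
        have e : P * ℓ * (ℓ * X + P * (ℓ⁻¹ * a ^ 2)) = ℓ ^ 2 * (P * X) + P ^ 2 * a ^ 2 := by
          field_simp
        rw [e]
        nlinarith [sq_nonneg (ℓ * A - P * a), mul_le_mul_of_nonneg_left hA (sq_nonneg ℓ)]
      exact le_of_mul_le_mul_left h (by positivity)
  have e : (ℓ + P) * (ℓ⁻¹ * a ^ 2 + X) = a ^ 2 + (ℓ * X + P * (ℓ⁻¹ * a ^ 2)) + P * X := by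
    field_simp
    ring
  rw [e]
  nlinarith [key, hA]

/-- For finitely supported `w`, `k ↦ ⟪v, Δ_s w k⟫²` is finitely supported. [folklore] -/
theorem hasFiniteSupport_sq_inner {w : Label → EuclideanSpace ℝ (Fin 3)} (hw : (support w).Finite)
    (v : EuclideanSpace ℝ (Fin 3)) (s : BondClass) :
    (fun k => (inner ℝ v (bondDiff s w k)) ^ 2).HasFiniteSupport := by
  have h : (bondDiff s w).HasFiniteSupport := PullbackStub.finite_support_bondDiff hw s
  exact h.fun_comp (g := fun x : EuclideanSpace ℝ (Fin 3) => (inner ℝ v x) ^ 2) (by simp)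

/-- **The chain induction** (telescoping, pointwise weighted Cauchy–Schwarz, summation and re-indexing):
if the chain `ch` started on sublattice `m` ends at the label class `(m', n)` and carries positive weights,
then for finitely supported `w` there is a nonnegative summable `Q` (the weighted square sum
`k ↦ Σ_j (wt s_j)⁻¹ ⟪v, Δ_{s_j} w (k + o_j)⟫²` along the chain) with
`⟪v, w (m', k + n) − w (m, k)⟫² ≤ (Σ_j wt s_j) · Q k` for every `k` and
`Σ'_k Q k = Σ_j (wt s_j)⁻¹ · dirForm v s_j w`. [folklore] -/
theorem chain_aux (v : EuclideanSpace ℝ (Fin 3)) (wt : BondClass → ℝ)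
    {w : Label → EuclideanSpace ℝ (Fin 3)} (hw : (support w).Finite) :
    ∀ (ch : List BondClass) (m m' : Fin 2) (n : Fin 3 → ℤ), chainEnd m ch = some (m', n) →
      (∀ s ∈ ch, 0 < wt s) →
        ∃ Q : (Fin 3 → ℤ) → ℝ, (∀ k, 0 ≤ Q k) ∧ Summable Q ∧
          (∀ k, (inner ℝ v (w (m', k + n) - w (m, k))) ^ 2 ≤ (ch.map wt).sum * Q k) ∧
          ∑' k, Q k = (ch.map fun s => (wt s)⁻¹ * dirForm v s w).sum
  | [], m, m', n, h, _ => by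
      simp only [chainEnd, Option.some.injEq, Prod.mk.injEq] at h
      obtain ⟨rfl, rfl⟩ := h
      exact ⟨fun _ => 0, fun _ => le_rfl, summable_zero, fun k => by simp, by simp⟩
  | s :: rest, m, m', n, h, hwt => by
      simp only [chainEnd] at h
      split_ifs at h with hs
      obtain ⟨⟨m'', n'⟩, h1, h2⟩ := Option.map_eq_some_iff.mp h
      simp only [Prod.mk.injEq] at h2
      obtain ⟨rfl, rfl⟩ := h2
      have hs0 : 0 < wt s := hwt s List.mem_cons_self
      have hrest : ∀ t ∈ rest, 0 < wt t := fun t ht => hwt t (List.mem_cons_of_mem s ht)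
      obtain ⟨Q, hQ0, hQs, hQle, hQt⟩ := chain_aux v wt hw rest s.2.1 m'' n' h1 hrest
      -- the weighted square sum of `s :: rest`: head term plus the shifted tail sum
      have hA : Summable fun k => (wt s)⁻¹ * (inner ℝ v (bondDiff s w k)) ^ 2 :=
        (summable_of_hasFiniteSupport (hasFiniteSupport_sq_inner hw v s)).mul_left _
      have hB : Summable fun k => Q (k + s.2.2) := (Equiv.summable_iff (Equiv.addRight s.2.2)).mpr hQs
      refine ⟨fun k => (wt s)⁻¹ * (inner ℝ v (bondDiff s w k)) ^ 2 + Q (k + s.2.2),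
        fun k => add_nonneg (mul_nonneg (inv_nonneg.mpr hs0.le) (sq_nonneg _)) (hQ0 _), hA.add hB,
        fun k => ?_, ?_⟩
      · -- telescoping of the composite difference, then one weighted Cauchy–Schwarz step
        have htel : w (m'', k + (s.2.2 + n')) - w (m, k) =
            bondDiff s w k + (w (m'', k + s.2.2 + n') - w (s.2.1, k + s.2.2)) := by
          rw [bondDiff, hs, add_assoc k]
          abel
        rw [htel, inner_add_right, List.map_cons, List.sum_cons]
        exact sq_add_le hs0
          (List.sum_nonneg fun x hx => by
            obtain ⟨t, ht, rfl⟩ := List.mem_map.mp hx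
            exact (hrest t ht).le)
          (hQ0 _) (hQle (k + s.2.2))
      · -- summation over the base point and the shift `k + n_s ↦ k`
        rw [hA.tsum_add hB, tsum_mul_left, List.map_cons, List.sum_cons, ← hQt]
        congr 1
        exact Equiv.tsum_eq (Equiv.addRight s.2.2) Q

/-- **S6 — CHAIN BOUND** (`stub_chainBound`): for a chain `ch` composing to `c`, positive weights `wt`,
every direction `v` and finitely supported `w`,
`dirForm v c w ≤ (Σ_j wt s_j) · Σ_j (wt s_j)⁻¹ · dirForm v s_j w`
(telescoping, pointwise weighted Cauchy–Schwarz, summation over the base point and re-indexing). [folklore] -/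
theorem stub_chainBound : ChainBound := by
  intro c ch hch wt hwt v w hw
  obtain ⟨Q, -, hQs, hQle, hQt⟩ := chain_aux v wt hw ch c.1 c.2.1 c.2.2 hch hwt
  have hle : ∀ k, (inner ℝ v (bondDiff c w k)) ^ 2 ≤ (ch.map wt).sum * Q k := fun k => hQle k
  calc dirForm v c w = ∑' k, (inner ℝ v (bondDiff c w k)) ^ 2 := rfl
    _ ≤ ∑' k, (ch.map wt).sum * Q k :=
        Summable.tsum_le_tsum hle (summable_of_hasFiniteSupport (hasFiniteSupport_sq_inner hw v c))
          (hQs.mul_left _)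
    _ = (ch.map wt).sum * (ch.map fun s => (wt s)⁻¹ * dirForm v s w).sum := by rw [tsum_mul_left, hQt]

end Summit.AtomisticToContinuum.Crystallization.Theorems.PhononStabilityCWC.ChainBoundStub

end
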